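import Literature.Analysis.FunctionSpaces.UniformRandomWalkDensityPlane
import Mathlib.Analysis.SpecialFunctions.Integrals.Basic
import Mathlib.Data.Nat.Choose.Vandermonde
import HarnessLib

/-!
# Short uniform random walks: the even moments `W_n(2k)` (Borwein–Nuyens–Straub–Wan)

Sibling file of `Literature/Analysis/FunctionSpaces/UniformRandomWalkDensity.lean`, about the laws
`uniformWalkLaw n` of the endpoint `S_n` of the `n`-step uniform planar walk
(`UniformRandomWalkDensityPlane.lean`). The even moments `W_n(2k) = E |S_n|^{2k}` are the
combinatorial backbone of [BorweinEtAl2012] (§1, (1.1)–(1.3): `W_n(2k) = Σ_{a₁+⋯+a_n = k}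
(k!/(a₁!⋯a_n!))²`; `W₃(2k) = Σ_j C(k,j)² C(2j,j)`; `W₄(2k)` = the Domb numbers, whose generating
function is the one modularly parametrised by Chan–Zudilin in the proof of Theorem 9). Everything
here is PROVED (theorems only; no definitions, no named facts):

* `ae_norm_le_uniformWalkLaw` — `|S_n| ≤ n` almost surely (the law is supported in the closed
  ball of radius `n`); `integral_uniformWalkLaw_succ` — `E f(S_{n+1}) = E ∫ f(S_n + e^{iθ}) dθ/2π`
  for continuous `f`;
* `integral_pow_mul_conj_pow_unitStepLaw` — the trigonometric moments of one step,
  `E[Z^c Z̄^d] = [c = d]`;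
* `integral_pow_mul_conj_pow_succ` — the binomial expansion
  `E[S_{n+1}^a S̄_{n+1}^b] = Σ_{i ≤ a, j ≤ b, a−i = b−j} C(a,i) C(b,j) E[S_n^i S̄_n^j]`;
* `integral_pow_mul_conj_pow_eq_zero` — **`E[S_n^a S̄_n^b] = 0` for `a ≠ b`** (rotation
  invariance);
* `integral_norm_pow_succ` — **the moment recursion `W_{n+1}(2k) = Σ_{j ≤ k} C(k,j)² W_n(2j)`**;
* `integral_norm_pow_one/two/three/four` — `W₁(2k) = 1`, `W₂(2k) = C(2k,k)` (Vandermonde),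
  **`W₃(2k) = Σ_j C(k,j)² C(2j,j)`** [BorweinEtAl2012, (1.1) with n = 3; BNSW Thm. 2.?] and
  `W₄(2k) = Σ_j C(k,j)² Σ_i C(j,i)² C(2i,i)` (the Domb numbers `1, 4, 28, 256, 2716, …`, here in the
  nested form delivered by the recursion; the closed form `Σ_j C(k,j)² C(2j,j) C(2k−2j,k−j)` of
  [BorweinEtAl2012, before Thm. 6] is the same sequence).

## References

* [BorweinEtAl2012] J. M. Borwein, A. Straub, J. Wan, W. Zudilin, Densities of short uniform random
  walks, Canad. J. Math. 64 (2012) 961–990 = arXiv:1103.2995, §1 (1.1)–(1.3), §4 (Domb numbers).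
* J. M. Borwein, D. Nuyens, A. Straub, J. Wan, Some arithmetic properties of short random walk
  integrals, Ramanujan J. 26 (2011) 109–132 (= [bnsw-rw] of the source), §2.
-/

noncomputable section

open _root_.MeasureTheory _root_.Set _root_.Real _root_.Complex _root_.Filter _root_.Metric Finset
open scoped ComplexConjugate

namespace Literature.Analysis.FunctionSpaces

/-! ### Supports: `|Z| = 1` and `|S_n| ≤ n` almost surely -/

/-- A uniform unit step has length `1` almost surely. [folklore] -/
theorem ae_norm_eq_one_unitStepLaw : ∀ᵐ z ∂unitStepLaw, ‖z‖ = 1 := by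
  unfold unitStepLaw
  refine Measure.ae_smul_measure ?_ _
  have hmeas : AEMeasurable (fun θ : ℝ => cexp (θ * I)) (volume.restrict (Ioc (0 : ℝ) (2 * π))) :=
    (Complex.continuous_exp.comp (Complex.continuous_ofReal.mul continuous_const)).measurable
      |>.aemeasurable
  refine (ae_map_iff hmeas (isClosed_eq continuous_norm continuous_const).measurableSet).mpr ?_
  exact ae_of_all _ fun θ => by simp [Complex.norm_exp_ofReal_mul_I]

/-- `|S_n + Z| ≤ n + 1` almost surely on the product of the laws of `S_n` and of a unit step,
given `|S_n| ≤ n` a.s. [folklore] -/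
theorem ae_norm_add_le_prod {n : ℕ} (h : ∀ᵐ z ∂(uniformWalkLaw n), ‖z‖ ≤ n) :
    ∀ᵐ p ∂((uniformWalkLaw n).prod unitStepLaw), ‖p.1 + p.2‖ ≤ n + 1 := by
  have hS : MeasurableSet {p : ℂ × ℂ | ‖p.1 + p.2‖ ≤ n + 1} :=
    (isClosed_le (continuous_norm.comp continuous_add) continuous_const).measurableSet
  rw [Measure.ae_prod_iff_ae_ae hS]
  filter_upwards [h] with x hx
  filter_upwards [ae_norm_eq_one_unitStepLaw] with y hy
  calc ‖x + y‖ ≤ ‖x‖ + ‖y‖ := norm_add_le x y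
    _ ≤ n + 1 := by rw [hy]; linarith

/-- **`|S_n| ≤ n` almost surely**: the law of the `n`-step walk is carried by the closed ball of
radius `n`. [folklore] -/
theorem ae_norm_le_uniformWalkLaw (n : ℕ) : ∀ᵐ z ∂(uniformWalkLaw n), ‖z‖ ≤ n := by
  induction n with
  | zero =>
    rw [uniformWalkLaw_zero, ae_dirac_iff (isClosed_le continuous_norm continuous_const).measurableSet]
    simp
  | succ n ih =>
    rw [uniformWalkLaw_succ, Measure.conv]
    refine (ae_map_iff measurable_add.aemeasurable
      (isClosed_le continuous_norm continuous_const).measurableSet).mpr ?_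
    have h := ae_norm_add_le_prod ih
    push_cast
    exact h

/-! ### Integration against the law of `S_{n+1} = S_n + Z` -/

/-- A continuous function of `S_n + Z` is integrable on the product of the laws. [folklore] -/
theorem integrable_comp_add_prod (n : ℕ) {f : ℂ → ℂ} (hf : Continuous f) :
    Integrable (fun p : ℂ × ℂ => f (p.1 + p.2)) ((uniformWalkLaw n).prod unitStepLaw) := by
  obtain ⟨C, hC⟩ := (isCompact_closedBall (0 : ℂ) (n + 1)).exists_bound_of_continuousOn
    hf.continuousOn
  refine Integrable.of_bound ((hf.comp continuous_add).aestronglyMeasurable) C ?_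
  filter_upwards [ae_norm_add_le_prod (ae_norm_le_uniformWalkLaw n)] with p hp
  exact hC _ (mem_closedBall_zero_iff.mpr hp)

/-- A continuous function is integrable against the law of `S_n`. [folklore] -/
theorem integrable_uniformWalkLaw (n : ℕ) {f : ℂ → ℂ} (hf : Continuous f) :
    Integrable f (uniformWalkLaw n) := by
  obtain ⟨C, hC⟩ := (isCompact_closedBall (0 : ℂ) n).exists_bound_of_continuousOn hf.continuousOn
  refine Integrable.of_bound hf.aestronglyMeasurable C ?_
  filter_upwards [ae_norm_le_uniformWalkLaw n] with z hz
  exact hC _ (mem_closedBall_zero_iff.mpr hz)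

/-- A continuous function is integrable against the law of one step. [folklore] -/
theorem integrable_unitStepLaw {f : ℂ → ℂ} (hf : Continuous f) : Integrable f unitStepLaw := by
  obtain ⟨C, hC⟩ := (isCompact_closedBall (0 : ℂ) 1).exists_bound_of_continuousOn hf.continuousOn
  refine Integrable.of_bound hf.aestronglyMeasurable C ?_
  filter_upwards [ae_norm_eq_one_unitStepLaw] with z hz
  exact hC _ (mem_closedBall_zero_iff.mpr hz.le)

/-- **`E f(S_{n+1}) = E_{S_n} E_Z f(S_n + Z)`** for continuous `f` (convolution and Fubini).
[folklore] -/
theorem integral_uniformWalkLaw_succ (n : ℕ) (f : ℂ → ℂ) (hf : Continuous f) :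
    ∫ z, f z ∂(uniformWalkLaw (n + 1)) = ∫ x, ∫ y, f (x + y) ∂unitStepLaw ∂(uniformWalkLaw n) := by
  rw [uniformWalkLaw_succ, Measure.conv, integral_map measurable_add.aemeasurable
    hf.aestronglyMeasurable, integral_prod _ (integrable_comp_add_prod n hf)]

/-! ### Trigonometric moments of one step -/

/-- On the unit circle `e^{iθ}`: `zᶜ z̄ᵈ = e^{i(c−d)θ}`. [folklore] -/
theorem cexp_pow_mul_conj_pow (θ : ℝ) (c d : ℕ) :
    cexp (θ * I) ^ c * conj (cexp (θ * I)) ^ d = cexp (((c : ℂ) - d) * I * θ) := by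
  rw [← Complex.exp_conj, ← Complex.exp_nat_mul, ← Complex.exp_nat_mul, ← Complex.exp_add]
  congr 1
  simp only [map_mul, Complex.conj_ofReal, Complex.conj_I]
  ring

/-- **Trigonometric moments of a uniform unit step**: `E[Zᶜ Z̄ᵈ] = [c = d]`
(`(2π)⁻¹ ∫₀^{2π} e^{i(c−d)θ} dθ`). [folklore] -/
theorem integral_pow_mul_conj_pow_unitStepLaw (c d : ℕ) :
    ∫ z, z ^ c * conj z ^ d ∂unitStepLaw = if c = d then 1 else 0 := by
  rw [integral_unitStepLaw _ (by fun_prop)]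
  simp_rw [cexp_pow_mul_conj_pow]
  have hπ : (2 * π : ℂ) ≠ 0 := by exact_mod_cast (by positivity : (2 * π : ℝ) ≠ 0)
  split_ifs with h
  · subst h
    simp only [sub_self, zero_mul, Complex.exp_zero, intervalIntegral.integral_const, sub_zero,
      Complex.real_smul, mul_one]
    push_cast
    field_simp
  · have hm : ((c : ℂ) - d) * I ≠ 0 := by
      refine mul_ne_zero ?_ I_ne_zero
      rw [sub_ne_zero]
      exact_mod_cast h
    rw [integral_exp_mul_complex hm]
    have h2 : cexp (((c : ℂ) - d) * I * ((2 * π : ℝ) : ℂ)) = 1 := by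
      have := Complex.exp_int_mul_two_pi_mul_I ((c : ℤ) - d)
      rw [← this]
      congr 1
      push_cast
      ring
    rw [h2]
    simp

/-! ### The binomial expansion of the mixed moments -/

/-- For fixed `x`: `E_Z[(x+Z)ᵃ (x̄+Z̄)ᵇ] = Σ_{i ≤ a} Σ_{j ≤ b} [a − i = b − j] C(a,i) C(b,j) xⁱ x̄ʲ`.
[folklore] -/
theorem integral_add_pow_mul_conj_add_pow_unitStepLaw (x : ℂ) (a b : ℕ) :
    ∫ y, (x + y) ^ a * conj (x + y) ^ b ∂unitStepLaw =
      ∑ i ∈ range (a + 1), ∑ j ∈ range (b + 1),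
        if a - i = b - j then (a.choose i : ℂ) * (b.choose j) * (x ^ i * conj x ^ j) else 0 := by
  -- expand the integrand
  have hexp : ∀ y : ℂ, (x + y) ^ a * conj (x + y) ^ b =
      ∑ i ∈ range (a + 1), ∑ j ∈ range (b + 1),
        (a.choose i : ℂ) * (b.choose j) * (x ^ i * conj x ^ j) * (y ^ (a - i) * conj y ^ (b - j)) := by
    intro y
    rw [map_add, add_pow, add_pow, Finset.sum_mul_sum]
    refine Finset.sum_congr rfl fun i _ => Finset.sum_congr rfl fun j _ => ?_
    ring
  simp_rw [hexp]
  rw [integral_finsetSum _ fun i _ => ?_]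
  · refine Finset.sum_congr rfl fun i _ => ?_
    rw [integral_finsetSum _ fun j _ => ?_]
    · refine Finset.sum_congr rfl fun j _ => ?_
      rw [integral_const_mul, integral_pow_mul_conj_pow_unitStepLaw]
      split_ifs <;> simp
    · exact (integrable_unitStepLaw (by fun_prop)).const_mul _
  · exact integrable_finsetSum _ fun j _ => (integrable_unitStepLaw (by fun_prop)).const_mul _

/-- **Mixed moments, one more step**:
`E[S_{n+1}ᵃ S̄_{n+1}ᵇ] = Σ_{i ≤ a} Σ_{j ≤ b} [a − i = b − j] C(a,i) C(b,j) E[S_nⁱ S̄_nʲ]`.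
[folklore] -/
theorem integral_pow_mul_conj_pow_succ (n a b : ℕ) :
    ∫ z, z ^ a * conj z ^ b ∂(uniformWalkLaw (n + 1)) =
      ∑ i ∈ range (a + 1), ∑ j ∈ range (b + 1),
        if a - i = b - j then (a.choose i : ℂ) * (b.choose j) *
          ∫ x, x ^ i * conj x ^ j ∂(uniformWalkLaw n) else 0 := by
  rw [integral_uniformWalkLaw_succ n _ (by fun_prop)]
  simp_rw [integral_add_pow_mul_conj_add_pow_unitStepLaw]
  rw [integral_finsetSum _ fun i _ => ?_]
  · refine Finset.sum_congr rfl fun i _ => ?_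
    rw [integral_finsetSum _ fun j _ => ?_]
    · refine Finset.sum_congr rfl fun j _ => ?_
      split_ifs
      · rw [integral_const_mul]
      · simp
    · split_ifs
      · exact (integrable_uniformWalkLaw n (by fun_prop)).const_mul _
      · simp
  · refine integrable_finsetSum _ fun j _ => ?_
    split_ifs
    · exact (integrable_uniformWalkLaw n (by fun_prop)).const_mul _
    · simp

/-- **Rotation invariance: `E[S_nᵃ S̄_nᵇ] = 0` for `a ≠ b`.** [folklore] -/
theorem integral_pow_mul_conj_pow_eq_zero (n : ℕ) {a b : ℕ} (hab : a ≠ b) :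
    ∫ z, z ^ a * conj z ^ b ∂(uniformWalkLaw n) = 0 := by
  induction n generalizing a b with
  | zero =>
    rw [uniformWalkLaw_zero, integral_dirac]
    rcases Nat.eq_zero_or_pos a with rfl | ha
    · have hb : b ≠ 0 := fun h => hab h.symm
      simp [zero_pow hb]
    · simp [zero_pow ha.ne']
  | succ n ih =>
    rw [integral_pow_mul_conj_pow_succ]
    refine Finset.sum_eq_zero fun i hi => Finset.sum_eq_zero fun j hj => ?_
    rw [Finset.mem_range] at hi hj
    split_ifs with h
    · have hij : i ≠ j := fun hij => hab (by omega)
      rw [ih hij, mul_zero]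
    · rfl

/-! ### The moment recursion and the first values -/

/-- `zᵏ z̄ᵏ = |z|^{2k}`. [folklore] -/
theorem pow_mul_conj_pow_self (z : ℂ) (k : ℕ) :
    z ^ k * conj z ^ k = ((‖z‖ ^ (2 * k) : ℝ) : ℂ) := by
  rw [← mul_pow, Complex.mul_conj, Complex.normSq_eq_norm_sq, pow_mul]
  push_cast
  ring

/-- `W_n(2k)` as a complex mixed moment: `E[S_nᵏ S̄_nᵏ] = E|S_n|^{2k}`. [folklore] -/
theorem integral_pow_mul_conj_pow_self (n k : ℕ) :
    ∫ z, z ^ k * conj z ^ k ∂(uniformWalkLaw n) = ((∫ z, ‖z‖ ^ (2 * k) ∂(uniformWalkLaw n) : ℝ) : ℂ) := by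
  simp_rw [pow_mul_conj_pow_self]
  exact integral_ofReal

/-- **The moment recursion `W_{n+1}(2k) = Σ_{j ≤ k} C(k,j)² W_n(2j)`** — equivalently
`W_n(2k) = Σ_{a₁+⋯+a_n=k} (k!/(a₁!⋯a_n!))²` [BorweinEtAl2012, (1.1)]. [cite: BorweinEtAl2012, §1 eq. (1.1)] -/
theorem integral_norm_pow_succ (n k : ℕ) :
    ∫ z, ‖z‖ ^ (2 * k) ∂(uniformWalkLaw (n + 1)) =
      ∑ j ∈ range (k + 1), ((k.choose j) ^ 2 : ℝ) * ∫ z, ‖z‖ ^ (2 * j) ∂(uniformWalkLaw n) := by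
  apply Complex.ofReal_injective
  rw [← integral_pow_mul_conj_pow_self, integral_pow_mul_conj_pow_succ]
  push_cast
  refine Finset.sum_congr rfl fun i hi => ?_
  rw [Finset.mem_range] at hi
  rw [Finset.sum_eq_single i]
  · rw [if_pos rfl, integral_pow_mul_conj_pow_self]
    ring
  · intro j hj hji
    rw [Finset.mem_range] at hj
    rw [if_neg (by omega)]
  · intro h
    exact absurd (Finset.mem_range.mpr hi) h

/-- `W₀(2k) = [k = 0]` (`S₀ = 0`). [folklore] -/
theorem integral_norm_pow_zero (k : ℕ) :
    ∫ z, ‖z‖ ^ (2 * k) ∂(uniformWalkLaw 0) = if k = 0 then 1 else 0 := by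
  rw [uniformWalkLaw_zero, integral_dirac]
  split_ifs with h
  · simp [h]
  · simp [h]

/-- **`W₁(2k) = 1`** (`|S₁| = 1`). [folklore] -/
theorem integral_norm_pow_one (k : ℕ) : ∫ z, ‖z‖ ^ (2 * k) ∂(uniformWalkLaw 1) = 1 := by
  rw [integral_norm_pow_succ]
  simp_rw [integral_norm_pow_zero]
  simp

/-- **`W₂(2k) = C(2k, k)`** (Vandermonde; the moments of `p₂(x) = 2/(π√(4−x²))`).
[cite: BorweinEtAl2012, §1 eq. (1.1)] -/
theorem integral_norm_pow_two (k : ℕ) :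
    ∫ z, ‖z‖ ^ (2 * k) ∂(uniformWalkLaw 2) = ((2 * k).choose k : ℝ) := by
  rw [integral_norm_pow_succ]
  simp_rw [integral_norm_pow_one, mul_one]
  exact_mod_cast Nat.sum_range_choose_sq k

/-- **`W₃(2k) = Σ_{j ≤ k} C(k,j)² C(2j,j)`** — the even moments of the three-step walk.
[cite: BorweinEtAl2012, §1 eq. (1.1)] -/
theorem integral_norm_pow_three (k : ℕ) :
    ∫ z, ‖z‖ ^ (2 * k) ∂(uniformWalkLaw 3) =
      ∑ j ∈ range (k + 1), ((k.choose j) ^ 2 * (2 * j).choose j : ℝ) := by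
  rw [integral_norm_pow_succ]
  simp_rw [integral_norm_pow_two]

/-- **`W₄(2k)` = the Domb numbers** `Σ_{j ≤ k} C(k,j)² W₃(2j) = Σ_j C(k,j)² Σ_i C(j,i)² C(2i,i)`
(`1, 4, 28, 256, 2716, …`), whose generating function is the Domb series `y₀` parametrised
modularly in the proof of [BorweinEtAl2012, Thm. 9]. [cite: BorweinEtAl2012, §1 eq. (1.1)] -/
theorem integral_norm_pow_four (k : ℕ) :
    ∫ z, ‖z‖ ^ (2 * k) ∂(uniformWalkLaw 4) =
      ∑ j ∈ range (k + 1), ((k.choose j) ^ 2 : ℝ) *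
        ∑ i ∈ range (j + 1), ((j.choose i) ^ 2 * (2 * i).choose i : ℝ) := by
  rw [integral_norm_pow_succ]
  simp_rw [integral_norm_pow_three]

/-- The first Domb numbers: `W₄(0) = 1`, `W₄(2) = 4`, `W₄(4) = 28`, `W₄(6) = 256`
[BorweinEtAl2012, §4]. [cite: BorweinEtAl2012, §4] -/
theorem integral_norm_pow_four_values :
    (∫ z, ‖z‖ ^ (2 * 0) ∂(uniformWalkLaw 4)) = 1 ∧ (∫ z, ‖z‖ ^ (2 * 1) ∂(uniformWalkLaw 4)) = 4 ∧
      (∫ z, ‖z‖ ^ (2 * 2) ∂(uniformWalkLaw 4)) = 28 ∧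
        (∫ z, ‖z‖ ^ (2 * 3) ∂(uniformWalkLaw 4)) = 256 := by
  have h4 : ∀ k : ℕ, ∫ z, ‖z‖ ^ (2 * k) ∂(uniformWalkLaw 4) =
      ((∑ j ∈ range (k + 1), (k.choose j) ^ 2 *
        ∑ i ∈ range (j + 1), (j.choose i) ^ 2 * (2 * i).choose i : ℕ) : ℝ) := fun k => by
    rw [integral_norm_pow_four]
    push_cast
    rfl
  refine ⟨?_, ?_, ?_, ?_⟩ <;> rw [h4] <;> norm_cast

end Literature.Analysis.FunctionSpaces

end
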